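import Mathlib
import Literature.RingTheory.MvPolynomial.LeadingExponents

/-!
# TropicalLinks / SchonResolves — monic members of `I` with standard tail (Gröbner basics GB5)

Route `ResolutionOfSingularities/TropicalLinks`, crux `SchonResolves`
(stmt-ResolutionOfSingularities-17234), line `zariski-toric-closure`, stub GB5 ("pseudo-reduced
representatives"): for a monomial order `m` on `k[X_σ]` (`k` a field), an ideal `I` and a leading
exponent `u ∈ E(I)` (tree `Literature.RingTheory.MvPolynomial.leadingExponents m I =
{deg_m f | f ∈ I, f ≠ 0}`) there is a **monic `g ∈ I` with `deg_m g = u` all of whose other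
exponents are standard**, i.e. not in `E(I)`: `X^u ≡ (k-combination of standard monomials) (mod I)`.
These are the elements of the reduced Gröbner basis when `u` runs over the minimal generators of
`E(I)`; here `u ∈ E(I)` is arbitrary.

* `schonResolves_exists_sub_mem_forall_notMem_leadingExponents` — **normal forms**: every `f` is
  congruent modulo `I` to a polynomial `r` with standard support (Mathlib's division algorithm
  `MonomialOrder.div_set` by the set of nonzero members of `I`);
* `schonResolves_exists_monic_standard_tail` (GB5, the registered stub): divide `X^u`; the
  difference `g := X^u - r ∈ I` has `coeff_u g = 1` (`u ∈ E(I)` is not an exponent of `r`), and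
  `deg_m g ∈ E(I)` is an exponent of `g`, hence equals `u`.

References: Cox–Little–O'Shea, *Ideals, Varieties, and Algorithms* (3rd ed., 2007), Ch. 5 §3,
Prop. 1 (normal forms modulo `I`) and Ch. 2 §7 (reduced Gröbner bases); Becker–Weispfenning,
*Gröbner Bases* (1993), §5.3 (the division algorithm, Mathlib `MonomialOrder.div_set`).
-/

-- single-problem summit: the doubled namespace component `ResolutionOfSingularities` is forced
set_option linter.dupNamespace false

namespace Summit.ResolutionOfSingularities.ResolutionOfSingularities.Theorems

open MvPolynomial

/-- **Normal forms modulo an ideal**: for a field `k`, a monomial order `m` and an ideal `I` of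
`k[X_σ]`, every `f` is congruent modulo `I` to some `r` none of whose exponents is a leading
exponent of `I` (division of `f` by the nonzero members of `I`). [folklore] -/
theorem schonResolves_exists_sub_mem_forall_notMem_leadingExponents {k : Type*} [Field k]
    {σ : Type*} (m : MonomialOrder σ) (I : Ideal (MvPolynomial σ k)) (f : MvPolynomial σ k) :
    ∃ r : MvPolynomial σ k, f - r ∈ I ∧
      ∀ a ∈ r.support, a ∉ Literature.RingTheory.MvPolynomial.leadingExponents m I := by
  -- divide `f` by the set `B` of nonzero members of `I` (unit leading coefficients over a field)
  have hB : ∀ b ∈ {b : MvPolynomial σ k | b ∈ I ∧ b ≠ 0}, IsUnit (m.leadingCoeff b) :=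
    fun b hb => isUnit_iff_ne_zero.mpr (m.leadingCoeff_ne_zero_iff.mpr hb.2)
  obtain ⟨q, r, hfr, -, hr⟩ := m.div_set hB f
  refine ⟨r, ?_, ?_⟩
  · -- `f - r` is the combination `Σ q_b • b` of members of `I`
    have hL : f - r = Finsupp.linearCombination (MvPolynomial σ k)
        (fun b : {b : MvPolynomial σ k | b ∈ I ∧ b ≠ 0} => (b : MvPolynomial σ k)) q := by
      rw [hfr, add_sub_cancel_right]
    rw [hL, Finsupp.linearCombination_apply]
    exact Submodule.sum_mem I fun b _ => I.smul_mem (q b) b.2.1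
  · -- an exponent `a = deg_m g` (`g ∈ I`, `g ≠ 0`) of `r` would be divisible by `deg_m g`
    rintro a ha ⟨g, hgI, hg0, hga⟩
    exact hr a ha g ⟨hgI, hg0⟩ hga.le

/-- **GB5 — monic members with standard tail.** For a field `k`, a monomial order `m` on
`k[X_σ]`, an ideal `I` and `u ∈ E(I)`, there is `g ∈ I` with `deg_m g = u`, leading coefficient
`1`, and every other exponent of `g` outside `E(I)` (a standard monomial): `g := X^u - r` for the
normal form `r` of `X^u`. [cite: CoxLittleOShea2007, Ch. 5 §3, Prop. 1 and Ch. 2 §7] -/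
theorem schonResolves_exists_monic_standard_tail : ∀ (k : Type) [Field k] (σ : Type) [Finite σ] (m : MonomialOrder σ) (I : Ideal (MvPolynomial σ k)) (u : σ →₀ ℕ), u ∈ Literature.RingTheory.MvPolynomial.leadingExponents m I → ∃ g ∈ I, m.degree g = u ∧ m.leadingCoeff g = 1 ∧ ∀ a ∈ g.support, a ≠ u → a ∉ Literature.RingTheory.MvPolynomial.leadingExponents m I := by
  intro k _ σ _ m I u hu
  classical
  -- normal form `r` of `X^u`; put `g := X^u - r ∈ I`
  obtain ⟨r, hgI, hr⟩ :=
    schonResolves_exists_sub_mem_forall_notMem_leadingExponents m I (monomial u (1 : k))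
  -- `u ∈ E(I)` is not an exponent of `r`, so `coeff_u g = 1`
  have hru : r.coeff u = 0 := by
    by_contra h
    exact hr u (mem_support_iff.mpr h) hu
  have hgu : (monomial u (1 : k) - r).coeff u = 1 := by
    rw [coeff_sub, coeff_monomial, if_pos rfl, hru, sub_zero]
  have hg0 : monomial u (1 : k) - r ≠ 0 := fun h => by
    rw [h, coeff_zero] at hgu
    exact zero_ne_one hgu
  -- every exponent of `g` other than `u` is an exponent of `r`, hence standard
  have htail : ∀ a ∈ (monomial u (1 : k) - r).support, a ≠ u →
      a ∉ Literature.RingTheory.MvPolynomial.leadingExponents m I := by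
    intro a ha hau
    rcases Finset.mem_union.mp (support_sub σ _ r ha) with h | h
    · exact absurd (Finset.mem_singleton.mp (support_monomial_subset h)) hau
    · exact hr a h
  -- `deg_m g ∈ E(I)` lies in the support of `g`, so it must be `u`
  have hdeg : m.degree (monomial u (1 : k) - r) = u := by
    by_contra hne
    exact htail _ (m.degree_mem_support hg0) hne ⟨_, hgI, hg0, rfl⟩
  refine ⟨monomial u 1 - r, hgI, hdeg, ?_, htail⟩
  -- leading coefficient `= coeff_u g = 1`
  change (monomial u (1 : k) - r).coeff (m.degree (monomial u (1 : k) - r)) = 1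
  rw [hdeg, hgu]

end Summit.ResolutionOfSingularities.ResolutionOfSingularities.Theorems
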